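import Literature.NumberTheory.GaloisCohomology.Howard2004.DVRSettingEngineEpsilonProofs
import Literature.NumberTheory.GaloisCohomology.Howard2004.DVRSettingEngineRhoProofs
import HarnessLib

/-!
# Howard 2004, Prop. 1.5.5 in the ENGINE's currency: «`ε` is independent of `n`» from the eigen-lengths `ρ^±`
# and the Lemma 1.5.3 dichotomies at an inert prime (PAR-ASM) — proofs file

Topic `NumberTheory/GaloisCohomology/Howard2004`. THEOREMS ONLY: no definition, no named fact, no instance, no
notation, no `sorry`. Sequel of `DVRSettingEngineEpsilonProofs` (x9-p1 LEAD g9, (EPS-CONST): the algebraic half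
`ε ≡ dim_{R/𝔪} 𝓗(n)[𝔪] (mod 2)` with the parity binder `hpar`) and `DVRSettingEngineRhoProofs` (x10b-p1-w8 g11,
(RHO-ID): `dim_{R/𝔪} 𝓗(n)[𝔪] = ρ⁺(n) + ρ⁻(n)` — Lemma 1.3.3 + the eigen-decomposition of `𝓗̄(n)`). Cell
`pub/bsd-print-x9`; print leaf G87 = `thm161_dvrKolyvaginBound` (Howard Thm. 1.6.1), registered pseudo-stub `stub_h161` of
the μ-crux `MuInequalityCoherentPair` (stmt-BirchSwinnertonDyer-22642).

SOURCE. B. Howard, *The Heegner point Kolyvagin system*, Compositio Math. **140** (2004) = arXiv:1202.6340, Lemma 1.5.3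
(p0009 L139 – p0010 L45: «(a) if `loc_ℓ(𝓗̄(n)^±) ≠ 0` then `ρ(nℓ)^± = ρ(n)^± − 1` …; (b) if `loc_ℓ(𝓗̄(n)^±) = 0` then
`ρ(nℓ)^± = ρ(n)^± + 1`. In particular this implies that `ρ(n) (mod 2)` is independent of `n ∈ 𝓝`») and Prop. 1.5.5
(p0010 L67–75: «`ε` … is congruent to `ρ(n) (mod 2)` and is therefore independent of `n ∈ 𝓝` by Lemma 1.5.3»).

WHAT IS PROVED (bookkeeping; the Lemma 1.5.3 DICHOTOMIES at the prime `q` enter as hypotheses `h153p` / `h153m` in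
the SAME abstract `ρ±`-letters as the engine binders `hchebI` / `hchebII`):
* **`DVRSetting.finrank_torsionBy_mod_two_eq_of_rho`** — «in particular `ρ(n) (mod 2)` is independent of `n`»:
  `dim 𝓗(n)[π] ≡ dim 𝓗(nq)[π] (mod 2)` (= the binder `hpar` of `epsilon_eq_of_linearEquiv_decompositions`);
* **`DVRSetting.epsilon_eq_of_linearEquiv_decompositions_of_rho`** — Prop. 1.5.5's «independent of `n`» for ARBITRARY
  decompositions at `n` and `nq` (`ε₁ = ε₂`), from `ρ±`, their identification `hρp`/`hρm` (RHO-ID) and the dichotomies.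

HONEST FRAMING: Lemma 1.5.3 itself (the dichotomies, from global duality and the isotropy at `q`) is NOT proved here;
`thm161_dvrKolyvaginBound` is NOT proved; no summit statement is proved; the Birch–Swinnerton-Dyer conjecture is not
proved by any of this.
-/

set_option autoImplicit false

noncomputable section

open Function NumberField IsDedekindDomain Field Module Submodule
open scoped NumberField ContRepresentation Classical Pointwise

namespace Literature.NumberTheory.GaloisCohomology.Howard2004

open Literature.NumberTheory.GaloisRepresentations
open Literature.NumberTheory.GaloisRepresentations.DiscreteGaloisModule
open Literature.NumberTheory.GaloisRepresentations.galoisCohomology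
open Literature.NumberTheory.EllipticCurves
open Literature.Algebra.Module

namespace DVRSetting

variable {p : ℕ} [Fact p.Prime] {K : Type} [Field K] [NumberField K]
  {R : Type} [CommRing R] [IsDomain R] [IsDiscreteValuationRing R] [Algebra ℤ_[p] R]
  {N : ℕ → Type} [∀ k, AddCommGroup (N k)] [∀ k, TopologicalSpace (N k)]
  [∀ k, DiscreteTopology (N k)] [∀ k, Module R (N k)]
  {Rk : ℕ → Type} [∀ k, CommRing (Rk k)] [∀ k, IsLocalRing (Rk k)] [∀ k, TopologicalSpace (Rk k)]
  [∀ k, DiscreteTopology (Rk k)] [∀ k, Algebra ℤ_[p] (Rk k)] [∀ k, Algebra R (Rk k)]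
  [∀ k, Module (Rk k) (N k)] [∀ k, IsScalarTower R (Rk k) (N k)]
  {Nbar : Type} [AddCommGroup Nbar] [TopologicalSpace Nbar] [DiscreteTopology Nbar]
  [∀ k, Module (Rk k) Nbar]
  {Nq : ℕ → Finset (HeightOneSpectrum (𝓞 K)) → Type} [∀ k n, AddCommGroup (Nq k n)]
  [∀ k n, TopologicalSpace (Nq k n)] [∀ k n, DiscreteTopology (Nq k n)]
  [∀ k n, Module (Rk k) (Nq k n)] [∀ k n, Module R (Nq k n)]
  [∀ k n, IsScalarTower R (Rk k) (Nq k n)]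

/-- `n ⊆ 𝓛^{(2k-1)}` and `q ∈ 𝓛^{(2k-1)}` give `nq ⊆ 𝓛^{(2k-1)}`. [cite: Howard2004HeegnerKolyvagin, §1.2 (arXiv p. 6 L98–100: «𝓝(𝓛)»)] -/
theorem insert_subset_enginePrimes (S : DVRSetting p K R N Rk Nbar Nq) {k : ℕ}
    {n : Finset (HeightOneSpectrum (𝓞 K))} {q : HeightOneSpectrum (𝓞 K)}
    (hn : ↑n ⊆ S.enginePrimes k) (hq : q ∈ S.enginePrimes k) :
    ↑(insert q n) ⊆ S.enginePrimes k := by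
  rw [Finset.coe_insert]
  exact Set.insert_subset hq hn

/-- **«In particular `ρ(n) (mod 2)` is independent of `n`» in the ENGINE's currency.** With eigen-lengths `ρ±`
identified with the lengths of `𝓗̄(n)^±` (RHO-ID's `hρp`/`hρm`), the Lemma 1.5.3 dichotomies at `q`
(`ρ±(nq) = ρ±(n) ∓ 1` or `ρ±(nq) = ρ±(n) + 1`, per sign) give
`dim_{R/(π)} 𝓗(n)[π] ≡ dim_{R/(π)} 𝓗(nq)[π] (mod 2)` — the binder `hpar` of `epsilon_eq_of_linearEquiv_decompositions`.
[cite: Howard2004HeegnerKolyvagin, Lemma 1.5.3 («In particular …») = arXiv:1202.6340 Lemma 2.5.3, p0009 L139 – p0010 L2] -/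
theorem finrank_torsionBy_mod_two_eq_of_rho (S : DVRSetting p K R N Rk Nbar Nq) (hy : S.SatisfiesH)
    (ρp ρm : ℕ → Finset (HeightOneSpectrum (𝓞 K)) → ℕ)
    (hρp : ∀ (k : ℕ) (n : Finset (HeightOneSpectrum (𝓞 K))), ↑n ⊆ S.enginePrimes k →
      letI := galoisCohomology.moduleH1 S.ρbar (S.isScalarLinear_rhobar hy k)
      (ρp k n : ℕ∞) = Module.length (Rk k) ↥(galoisCohomology.submoduleOfStable (S.isScalarLinear_rhobar hy k)
        ((((hy.h1 k).1.propagateStructure (S.t k).cond).modify (transverseStructure p S.ρbar S.jbar)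
            ∅ ∅ n).selmerGroup ⊓
          (semilinearH S.cd.isLift (S.A k).θ.toAddMonoidHom (S.A k).isSemilinear 1 - AddMonoidHom.id _).ker)
        (S.scalarMapH1_mem_residualSelmer_inf_ker_sub hy k ∅ ∅ n)))
    (hρm : ∀ (k : ℕ) (n : Finset (HeightOneSpectrum (𝓞 K))), ↑n ⊆ S.enginePrimes k →
      letI := galoisCohomology.moduleH1 S.ρbar (S.isScalarLinear_rhobar hy k)
      (ρm k n : ℕ∞) = Module.length (Rk k) ↥(galoisCohomology.submoduleOfStable (S.isScalarLinear_rhobar hy k)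
        ((((hy.h1 k).1.propagateStructure (S.t k).cond).modify (transverseStructure p S.ρbar S.jbar)
            ∅ ∅ n).selmerGroup ⊓
          (semilinearH S.cd.isLift (S.A k).θ.toAddMonoidHom (S.A k).isSemilinear 1 + AddMonoidHom.id _).ker)
        (S.scalarMapH1_mem_residualSelmer_inf_ker_add hy k ∅ ∅ n)))
    (k : ℕ) (n : Finset (HeightOneSpectrum (𝓞 K))) (q : HeightOneSpectrum (𝓞 K))
    (hn : ↑n ⊆ S.enginePrimes k) (hq : q ∈ S.enginePrimes k)
    (h153p : ρp k (insert q n) + 1 = ρp k n ∨ ρp k (insert q n) = ρp k n + 1)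
    (h153m : ρm k (insert q n) + 1 = ρm k n ∨ ρm k (insert q n) = ρm k n + 1) :
    letI := galoisCohomology.moduleH1 (S.T.ρ k) (S.T.hlin k)
    Module.finrank (R ⧸ R ∙ S.π) ↥(torsionBy R ↥(S.selmerModuleAt hy k n) S.π) % 2 =
      Module.finrank (R ⧸ R ∙ S.π) ↥(torsionBy R ↥(S.selmerModuleAt hy k (insert q n)) S.π) % 2 := by
  letI := galoisCohomology.moduleH1 (S.T.ρ k) (S.T.hlin k)
  rw [S.finrank_torsionBy_selmerModuleAt_eq_add hy ρp ρm hρp hρm k n hn,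
    S.finrank_torsionBy_selmerModuleAt_eq_add hy ρp ρm hρp hρm k (insert q n) (S.insert_subset_enginePrimes hn hq)]
  omega

/-- **HOWARD 2004, PROP. 1.5.5 — «`ε` is independent of `n`» from the eigen-lengths and the Lemma 1.5.3 dichotomies
(ENGINE form).** For `n ⊆ 𝓛^{(2k-1)}`, `q ∈ 𝓛^{(2k-1)} ∖ n`, ANY `R`-linear decompositions
`𝓗(n) ≃ (R/𝔪^{e_k})^{ε₁} × (M₁ × M₁)`, `𝓗(nq) ≃ (R/𝔪^{e_k})^{ε₂} × (M₂ × M₂)` (`εᵢ ≤ 1`, `Mᵢ` finite) have `ε₁ = ε₂`,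
given `ρ±` with RHO-ID's identifications and `ρ±(nq) ∈ {ρ±(n) − 1, ρ±(n) + 1}` per sign
(`epsilon_eq_of_linearEquiv_decompositions` ∘ `finrank_torsionBy_mod_two_eq_of_rho`).
[cite: Howard2004HeegnerKolyvagin, Prop. 1.5.5 and Lemma 1.5.3 = arXiv:1202.6340 Prop. 2.5.5 / Lemma 2.5.3, p0009 L139 – p0010 L75] -/
theorem epsilon_eq_of_linearEquiv_decompositions_of_rho (S : DVRSetting p K R N Rk Nbar Nq) (hy : S.SatisfiesH)
    (ρp ρm : ℕ → Finset (HeightOneSpectrum (𝓞 K)) → ℕ)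
    (hρp : ∀ (k : ℕ) (n : Finset (HeightOneSpectrum (𝓞 K))), ↑n ⊆ S.enginePrimes k →
      letI := galoisCohomology.moduleH1 S.ρbar (S.isScalarLinear_rhobar hy k)
      (ρp k n : ℕ∞) = Module.length (Rk k) ↥(galoisCohomology.submoduleOfStable (S.isScalarLinear_rhobar hy k)
        ((((hy.h1 k).1.propagateStructure (S.t k).cond).modify (transverseStructure p S.ρbar S.jbar)
            ∅ ∅ n).selmerGroup ⊓
          (semilinearH S.cd.isLift (S.A k).θ.toAddMonoidHom (S.A k).isSemilinear 1 - AddMonoidHom.id _).ker)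
        (S.scalarMapH1_mem_residualSelmer_inf_ker_sub hy k ∅ ∅ n)))
    (hρm : ∀ (k : ℕ) (n : Finset (HeightOneSpectrum (𝓞 K))), ↑n ⊆ S.enginePrimes k →
      letI := galoisCohomology.moduleH1 S.ρbar (S.isScalarLinear_rhobar hy k)
      (ρm k n : ℕ∞) = Module.length (Rk k) ↥(galoisCohomology.submoduleOfStable (S.isScalarLinear_rhobar hy k)
        ((((hy.h1 k).1.propagateStructure (S.t k).cond).modify (transverseStructure p S.ρbar S.jbar)
            ∅ ∅ n).selmerGroup ⊓
          (semilinearH S.cd.isLift (S.A k).θ.toAddMonoidHom (S.A k).isSemilinear 1 + AddMonoidHom.id _).ker)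
        (S.scalarMapH1_mem_residualSelmer_inf_ker_add hy k ∅ ∅ n)))
    (k : ℕ) (n : Finset (HeightOneSpectrum (𝓞 K))) (q : HeightOneSpectrum (𝓞 K))
    (hn : ↑n ⊆ S.enginePrimes k) (hq : q ∈ S.enginePrimes k) (hqn : q ∉ n)
    (h153p : ρp k (insert q n) + 1 = ρp k n ∨ ρp k (insert q n) = ρp k n + 1)
    (h153m : ρm k (insert q n) + 1 = ρm k n ∨ ρm k (insert q n) = ρm k n + 1)
    {ε₁ ε₂ : ℕ} {M₁ M₂ : Type} [AddCommGroup M₁] [Module R M₁] [AddCommGroup M₂] [Module R M₂]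
    [Finite M₁] [Finite M₂] (hε₁ : ε₁ ≤ 1) (hε₂ : ε₂ ≤ 1)
    (h₁ : letI := galoisCohomology.moduleH1 (S.T.ρ k) (S.T.hlin k)
      Nonempty (↥(S.selmerModuleAt hy k n) ≃ₗ[R]
        ((Fin ε₁ → R ⧸ IsLocalRing.maximalIdeal R ^ S.e k) × (M₁ × M₁))))
    (h₂ : letI := galoisCohomology.moduleH1 (S.T.ρ k) (S.T.hlin k)
      Nonempty (↥(S.selmerModuleAt hy k (insert q n)) ≃ₗ[R]
        ((Fin ε₂ → R ⧸ IsLocalRing.maximalIdeal R ^ S.e k) × (M₂ × M₂)))) :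
    ε₁ = ε₂ :=
  S.epsilon_eq_of_linearEquiv_decompositions hy k n q hn hq hqn hε₁ hε₂ h₁ h₂
    (S.finrank_torsionBy_mod_two_eq_of_rho hy ρp ρm hρp hρm k n q hn hq h153p h153m)

end DVRSetting

end Literature.NumberTheory.GaloisCohomology.Howard2004
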